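import Summits.QuantumFields.GaugeBoot.StrongCouplingThirdOrderWords
import Summits.QuantumFields.GaugeBoot.StrongCouplingPlaquetteSUNPieces
import HarnessLib

/-!
# Strong coupling from the loop equation: the deformed-plaquette terms are `O(β²)` (gauge-boot, ADDENDUM 24 part E)

HONEST FRAMING (cell `pub-gaugeboot`, page 1 of every file): the venture produces certified bounds
on lattice expectations at stated coupling, gauge group, dimension and torus size; NOT a mass gap,
NOT a continuum limit, NOT a string tension; NOT Yang–Mills-summit-bearing (barriers
`FixedCouplingUltralocality`, `PerturbativeInvisibility`).  Crude explicit `O(β²)` bounds on a finite torus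
`(ℤ/L)^d`, `L ≥ 2`, every real `β` (tree coupling `β = β_std/N`); no number of the cell's tables is certified here.

## Content (`SU(N)`, `N ≥ 2`, fundamental representation)

In the loop equation of the plaquette `P̃₀ = plaqWord μ ν₀ true` at `(x, μ)` the deformation by another plaquette word
`q = plaqWord μ ν ε` through the edge (`(ν, ε) ≠ (ν₀, +)`) contributes
`T_{ν,ε} = E[tr hol(P̃₀q)] − E[tr hol(P̃₀q⁻¹)] − (1/N)(E[tr U_P · tr hol q] − E[tr U_P · tr hol q⁻¹])`.
ADDENDUM 22 bounded `T_{ν,ε} = O(β)` (one further loop-equation step closed by `|tr| ≤ N`).  Here the further step is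
written as an EXACT equation whose plaquette terms — the level-3 words of `StrongCouplingThirdOrderWords` — are all
`O(β)`, so that every constituent of `T_{ν,ε}` is `O(β²)` (two plaquettes glued along a link span area two):

* `norm_integral_trace_plaqWord_append_qw_le₂` — ★★ for `w ∈ {q, q⁻¹}`:
  `‖E[tr hol_x(P̃₀ · w)]‖ ≤ 16(d−1)²N³β²/(N²−1)²`;
* `norm_integral_trace_mul_trace_qw_le₂` — ★★ `‖E[tr U_P · tr hol_x w]‖ ≤ 16(d−1)²N⁴β²/(N²−1)²`;
* `norm_plaqTermIntegral_le₂` — ★★ `‖T_{ν,ε}‖ ≤ 64(d−1)²N³β²/(N²−1)²` for every `(ν, ε) ≠ (ν₀, +)`, `ν ≠ μ`.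

These are the `O(β²)` inputs of the third-order plaquette expansion (ADDENDUM 24, `StrongCouplingPlaquetteSU3Third`).

References: Yu. Makeenko, *Methods of contemporary gauge theory* (2002) Problem 12.7; R. Balian, J.-M. Drouffe,
C. Itzykson, Phys. Rev. D 11 (1975) 2104.  Everything is `[folklore]`.
-/

noncomputable section

open MeasureTheory Filter Topology NormedSpace
open scoped Matrix.Norms.Frobenius Matrix
open Literature.MathematicalPhysics.QuantumFieldTheory Literature.MathematicalPhysics.QuantumLattice
open Summit.QuantumFields.YangMills.Cruxes.CurvatureAmnesia.WardDefect.SchwingerDyson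

namespace Summit.QuantumFields.GaugeBoot

namespace StrongCoupling

variable {d L N : ℕ} [NeZero L]

/-! ## Algebraic helpers -/

omit [NeZero L] in
/-- From `c·z = −(β/2)·S` with `c > 0` and `‖S‖ ≤ B`: `‖z‖ ≤ (|β|/2)·B/c`. [folklore] -/
theorem norm_le_of_coeff_mul_eq {c : ℝ} (hc : 0 < c) {z S : ℂ} {β B : ℝ} (h : (c : ℂ) * z = -((β / 2 : ℂ) * S))
    (hS : ‖S‖ ≤ B) : ‖z‖ ≤ |β| / 2 * B / c := by
  have hn := congrArg (fun z : ℂ => ‖z‖) h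
  simp only [norm_mul, norm_neg, Complex.norm_real, Real.norm_eq_abs, abs_of_pos hc, norm_half_ofReal] at hn
  rw [le_div_iff₀ hc, mul_comm ‖z‖, hn]
  exact mul_le_mul_of_nonneg_left hS (by positivity)

omit [NeZero L] in
/-- A double sum over the `2(d−1)` plaquettes through a link, each term bounded by `B`. [folklore] -/
theorem norm_sum_sum_le_of_le {κ : Fin d} {f : Fin d → Bool → ℂ} {B : ℝ}
    (h : ∀ ν ∈ Finset.univ.erase κ, ∀ ε : Bool, ‖f ν ε‖ ≤ B) :
    ‖∑ ν ∈ Finset.univ.erase κ, ∑ ε : Bool, f ν ε‖ ≤ ((d : ℝ) - 1) * (2 * B) := by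
  calc _ ≤ ∑ ν ∈ Finset.univ.erase κ, ‖∑ ε : Bool, f ν ε‖ := norm_sum_le _ _
    _ ≤ ∑ ν ∈ Finset.univ.erase κ, 2 * B := by
        refine Finset.sum_le_sum fun ν hν => (norm_sum_le _ _).trans ?_
        calc _ ≤ ∑ _ε : Bool, B := Finset.sum_le_sum fun ε _ => h ν hν ε
          _ = 2 * B := by simp [two_mul]
    _ = ((d : ℝ) - 1) * (2 * B) := by rw [Finset.sum_const, nsmul_eq_mul, card_univ_erase_real]

omit [NeZero L] in
/-- The four-piece bound `‖A − B − (1/N)(C − D)‖ ≤ a + a + (1/N)(c + c)`. [folklore] -/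
theorem norm_four_piece_le {A B C D : ℂ} {a c : ℝ} {N : ℕ} (hA : ‖A‖ ≤ a) (hB : ‖B‖ ≤ a) (hC : ‖C‖ ≤ c)
    (hD : ‖D‖ ≤ c) : ‖A - B - 1 / (N : ℂ) * (C - D)‖ ≤ 2 * a + 1 / N * (2 * c) := by
  have hNinv : ‖(1 / (N : ℂ))‖ = 1 / N := by rw [norm_div, norm_one, Complex.norm_natCast]
  refine (norm_sub_le _ _).trans ?_
  rw [norm_mul, hNinv]
  have h1 := (norm_sub_le A B).trans (add_le_add hA hB)
  have h2 := (norm_sub_le C D).trans (add_le_add hC hD)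
  have h3 : 1 / (N : ℝ) * ‖C - D‖ ≤ 1 / N * (2 * c) := mul_le_mul_of_nonneg_left (by linarith) (by positivity)
  linarith

/-- **The plaquette term with a spectator, integrated** (`SU(N)`): `∫ plaqTerm_{ν,ε}(W)·tr hol v =
E[tr hol(W·P̃) tr hol v] − E[tr hol(W·P̃⁻¹) tr hol v] − (1/N)(E[tr hol W · tr hol P̃ · tr hol v] − E[tr hol W · tr hol P̃⁻¹ · tr hol v])`.
[folklore] -/
theorem integral_plaqTerm_mul_trace_suN (β : ℝ) (z : Site d L) (κ : Fin d) (W : Word d) (ν : Fin d) (ε : Bool)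
    (x₁ : Site d L) (v : Word d) :
    ∫ U, plaqTerm (fundamentalRep (Fin N)) 1 z κ U W ν ε * (fundamentalRep (Fin N) (wordHolonomy U x₁ v)).trace
        ∂(wilsonMeasure (d := d) (L := L) (fundamentalRep (Fin N)) β) =
      (∫ U, (fundamentalRep (Fin N) (wordHolonomy U z (W ++ plaqWord κ ν ε))).trace *
          (fundamentalRep (Fin N) (wordHolonomy U x₁ v)).trace ∂(wilsonMeasure (d := d) (L := L) (fundamentalRep (Fin N)) β)) -
        (∫ U, (fundamentalRep (Fin N) (wordHolonomy U z (W ++ (plaqWord κ ν ε).reverse))).trace *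
          (fundamentalRep (Fin N) (wordHolonomy U x₁ v)).trace ∂(wilsonMeasure (d := d) (L := L) (fundamentalRep (Fin N)) β)) -
        1 / (N : ℂ) * ((∫ U, (fundamentalRep (Fin N) (wordHolonomy U z W)).trace *
            (fundamentalRep (Fin N) (wordHolonomy U z (plaqWord κ ν ε))).trace *
            (fundamentalRep (Fin N) (wordHolonomy U x₁ v)).trace ∂(wilsonMeasure (d := d) (L := L) (fundamentalRep (Fin N)) β)) -
          (∫ U, (fundamentalRep (Fin N) (wordHolonomy U z W)).trace *
            (fundamentalRep (Fin N) (wordHolonomy U z (plaqWord κ ν ε).reverse)).trace *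
            (fundamentalRep (Fin N) (wordHolonomy U x₁ v)).trace ∂(wilsonMeasure (d := d) (L := L) (fundamentalRep (Fin N)) β))) := by
  have hc : ∀ (y : Site d L) (u : Word d), Continuous fun U : GaugeConfig d L (Matrix.specialUnitaryGroup (Fin N) ℂ) =>
      (fundamentalRep (Fin N) (wordHolonomy U y u)).trace :=
    fun y u => continuous_trace_wordHolonomy (fundamentalLatticeRep N) y u
  have hA : Integrable (fun U : GaugeConfig d L (Matrix.specialUnitaryGroup (Fin N) ℂ) =>
      (fundamentalRep (Fin N) (wordHolonomy U z (W ++ plaqWord κ ν ε))).trace *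
        (fundamentalRep (Fin N) (wordHolonomy U x₁ v)).trace) (wilsonMeasure (d := d) (L := L) (fundamentalRep (Fin N)) β) :=
    integrable_of_continuous (fundamentalLatticeRep N) β ((hc z _).mul (hc x₁ v))
  have hB : Integrable (fun U : GaugeConfig d L (Matrix.specialUnitaryGroup (Fin N) ℂ) =>
      (fundamentalRep (Fin N) (wordHolonomy U z (W ++ (plaqWord κ ν ε).reverse))).trace *
        (fundamentalRep (Fin N) (wordHolonomy U x₁ v)).trace) (wilsonMeasure (d := d) (L := L) (fundamentalRep (Fin N)) β) :=
    integrable_of_continuous (fundamentalLatticeRep N) β ((hc z _).mul (hc x₁ v))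
  have hC : Integrable (fun U : GaugeConfig d L (Matrix.specialUnitaryGroup (Fin N) ℂ) =>
      1 / (N : ℂ) * ((fundamentalRep (Fin N) (wordHolonomy U z W)).trace *
        (fundamentalRep (Fin N) (wordHolonomy U z (plaqWord κ ν ε))).trace *
        (fundamentalRep (Fin N) (wordHolonomy U x₁ v)).trace)) (wilsonMeasure (d := d) (L := L) (fundamentalRep (Fin N)) β) :=
    integrable_of_continuous (fundamentalLatticeRep N) β (continuous_const.mul (((hc z W).mul (hc z _)).mul (hc x₁ v)))
  have hD : Integrable (fun U : GaugeConfig d L (Matrix.specialUnitaryGroup (Fin N) ℂ) =>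
      1 / (N : ℂ) * ((fundamentalRep (Fin N) (wordHolonomy U z W)).trace *
        (fundamentalRep (Fin N) (wordHolonomy U z (plaqWord κ ν ε).reverse)).trace *
        (fundamentalRep (Fin N) (wordHolonomy U x₁ v)).trace)) (wilsonMeasure (d := d) (L := L) (fundamentalRep (Fin N)) β) :=
    integrable_of_continuous (fundamentalLatticeRep N) β (continuous_const.mul (((hc z W).mul (hc z _)).mul (hc x₁ v)))
  have hpt : ∀ U : GaugeConfig d L (Matrix.specialUnitaryGroup (Fin N) ℂ),
      plaqTerm (fundamentalRep (Fin N)) 1 z κ U W ν ε * (fundamentalRep (Fin N) (wordHolonomy U x₁ v)).trace =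
      ((fundamentalRep (Fin N) (wordHolonomy U z (W ++ plaqWord κ ν ε))).trace *
          (fundamentalRep (Fin N) (wordHolonomy U x₁ v)).trace -
        (fundamentalRep (Fin N) (wordHolonomy U z (W ++ (plaqWord κ ν ε).reverse))).trace *
          (fundamentalRep (Fin N) (wordHolonomy U x₁ v)).trace) -
      (1 / (N : ℂ) * ((fundamentalRep (Fin N) (wordHolonomy U z W)).trace *
          (fundamentalRep (Fin N) (wordHolonomy U z (plaqWord κ ν ε))).trace *
          (fundamentalRep (Fin N) (wordHolonomy U x₁ v)).trace) -
        1 / (N : ℂ) * ((fundamentalRep (Fin N) (wordHolonomy U z W)).trace *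
          (fundamentalRep (Fin N) (wordHolonomy U z (plaqWord κ ν ε).reverse)).trace *
          (fundamentalRep (Fin N) (wordHolonomy U x₁ v)).trace)) := fun U => by
    simp only [plaqTerm]; ring
  have hAB : Integrable (fun U : GaugeConfig d L (Matrix.specialUnitaryGroup (Fin N) ℂ) =>
      (fundamentalRep (Fin N) (wordHolonomy U z (W ++ plaqWord κ ν ε))).trace *
          (fundamentalRep (Fin N) (wordHolonomy U x₁ v)).trace -
        (fundamentalRep (Fin N) (wordHolonomy U z (W ++ (plaqWord κ ν ε).reverse))).trace *
          (fundamentalRep (Fin N) (wordHolonomy U x₁ v)).trace) (wilsonMeasure (d := d) (L := L) (fundamentalRep (Fin N)) β) :=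
    hA.sub hB
  have hCD : Integrable (fun U : GaugeConfig d L (Matrix.specialUnitaryGroup (Fin N) ℂ) =>
      1 / (N : ℂ) * ((fundamentalRep (Fin N) (wordHolonomy U z W)).trace *
          (fundamentalRep (Fin N) (wordHolonomy U z (plaqWord κ ν ε))).trace *
          (fundamentalRep (Fin N) (wordHolonomy U x₁ v)).trace) -
        1 / (N : ℂ) * ((fundamentalRep (Fin N) (wordHolonomy U z W)).trace *
          (fundamentalRep (Fin N) (wordHolonomy U z (plaqWord κ ν ε).reverse)).trace *
          (fundamentalRep (Fin N) (wordHolonomy U x₁ v)).trace)) (wilsonMeasure (d := d) (L := L) (fundamentalRep (Fin N)) β) :=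
    hC.sub hD
  simp_rw [hpt]
  rw [integral_sub hAB hCD, integral_sub hA hB, integral_sub hC hD, integral_const_mul, integral_const_mul]
  ring

/-! ## The deformed single traces `E[tr hol(P̃₀ · w)]` are `O(β²)` -/

section Main

/-- `(N − 1/N)` as a positive real for `N ≥ 2`. [folklore] -/
theorem coeff_pos (hN : 2 ≤ N) : (0 : ℝ) < ((N : ℝ) ^ 2 - 1) / N := by
  have : (2 : ℝ) ≤ N := by exact_mod_cast hN
  exact div_pos (by nlinarith) (by linarith)

omit [NeZero L] in
/-- `(N:ℂ) − 1/N = ((N²−1)/N : ℝ)`. [folklore] -/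
theorem coeff_cast (hN : 2 ≤ N) : ((N : ℂ) - 1 / N) = ((((N : ℝ) ^ 2 - 1) / N : ℝ) : ℂ) := by
  have : (2 : ℝ) ≤ N := by exact_mod_cast hN
  have hN0 : (N : ℂ) ≠ 0 := by exact_mod_cast (show (N : ℝ) ≠ 0 by linarith)
  push_cast
  field_simp

/-- ★★ **`‖E[tr hol_x(P̃₀ · w)]‖ ≤ 16(d−1)²N³β²/(N²−1)²`** for `w ∈ {q, q⁻¹}`, `q = plaqWord μ ν ε`, `(ν, ε) ≠ (ν₀, +)`,
`ν ≠ μ` (`SU(N)`, `N ≥ 2`, every `L ≥ 2`, every real `β`): the loop equation of the rotated word `+ν₀ −μ −ν₀ · w · +μ` at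
`(x + e_μ, ν₀)` has all its `8(d−1)` plaquette-term constituents `O(β)` (`StrongCouplingThirdOrderWords`). [folklore] -/
theorem norm_integral_trace_plaqWord_append_qw_le₂ (hN : 2 ≤ N) (hL : (1 : ZMod L) ≠ 0) (β : ℝ) (x : Site d L)
    {μ ν₀ ν : Fin d} (hμν₀ : μ ≠ ν₀) (hνμ : ν ≠ μ) {ε : Bool} (hne : ¬(ν = ν₀ ∧ ε = true)) {w : Word d}
    (hw : w = plaqWord μ ν ε ∨ w = (plaqWord μ ν ε).reverse) :
    ‖∫ U, (fundamentalRep (Fin N) (wordHolonomy U x (plaqWord μ ν₀ true ++ w))).trace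
        ∂(wilsonMeasure (d := d) (L := L) (fundamentalRep (Fin N)) β)‖ ≤
      16 * ((d : ℝ) - 1) ^ 2 * (N : ℝ) ^ 3 * β ^ 2 / ((N : ℝ) ^ 2 - 1) ^ 2 := by
  have hN2 : (2 : ℝ) ≤ N := by exact_mod_cast hN
  have hNpos : (0 : ℝ) < N := by linarith
  have hN21 : (0 : ℝ) < (N : ℝ) ^ 2 - 1 := by nlinarith
  have hd1 : (0 : ℝ) ≤ (d : ℝ) - 1 := sub_one_nonneg_of_axis μ
  have hwx : Word.endpoint x w = x := endpoint_qw x ε hw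
  have hμν : μ ≠ ν := fun h => hνμ h.symm
  have havoid : Word.Avoids x w (x.shift μ, ν₀) := by
    rcases hw with rfl | rfl
    · exact avoids_plaqWord hL x hμν₀ hμν hne
    · exact avoids_plaqWord_reverse hL x hμν₀ hμν hne
  set rw' : Word d := .fwd ν₀ :: .bwd μ :: .bwd ν₀ :: (w ++ [.fwd μ]) with hrw
  -- the loop equation of the rotated word at `(x + e_μ, ν₀)`
  have heq := coeff_mul_integral_trace_eq (d := d) (L := L) (fundamentalLatticeRep N) β (x.shift μ) ν₀ 1 rw'
    (endpoint_rot x μ ν₀ w hwx) (fun U => sum_splitTerm_rot (fundamentalRep (Fin N)) hL 1 x hμν₀ U havoid hwx)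
    (fun i j => sdPair_specialUnitaryGroup N β (x.shift μ) ν₀ (x.shift μ) rw' _ (trace_unitDir_one i j))
  simp only [integral_plaqTerm_latticeRep (fundamentalLatticeRep N)] at heq
  simp only [fundamentalLatticeRep_N, fundamentalLatticeRep_ρ] at heq
  -- restated on the nose
  have heq' : ((N : ℂ) - 1 / N) * (∫ U, (fundamentalRep (Fin N) (wordHolonomy U (x.shift μ) rw')).trace
      ∂(wilsonMeasure (d := d) (L := L) (fundamentalRep (Fin N)) β)) =
      -((β / 2 : ℂ) * ∑ ν' ∈ Finset.univ.erase ν₀, ∑ ε' : Bool,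
        ((∫ U, (fundamentalRep (Fin N) (wordHolonomy U (x.shift μ) (rw' ++ plaqWord ν₀ ν' ε'))).trace
            ∂(wilsonMeasure (d := d) (L := L) (fundamentalRep (Fin N)) β)) -
          (∫ U, (fundamentalRep (Fin N) (wordHolonomy U (x.shift μ) (rw' ++ (plaqWord ν₀ ν' ε').reverse))).trace
            ∂(wilsonMeasure (d := d) (L := L) (fundamentalRep (Fin N)) β)) -
          1 / (N : ℂ) * ((∫ U, (fundamentalRep (Fin N) (wordHolonomy U (x.shift μ) rw')).trace *
              (fundamentalRep (Fin N) (wordHolonomy U (x.shift μ) (plaqWord ν₀ ν' ε'))).trace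
                ∂(wilsonMeasure (d := d) (L := L) (fundamentalRep (Fin N)) β)) -
            (∫ U, (fundamentalRep (Fin N) (wordHolonomy U (x.shift μ) rw')).trace *
              (fundamentalRep (Fin N) (wordHolonomy U (x.shift μ) (plaqWord ν₀ ν' ε').reverse)).trace
                ∂(wilsonMeasure (d := d) (L := L) (fundamentalRep (Fin N)) β))))) := heq
  -- bound on the plaquette terms
  set C₀ : ℝ := 4 * ((d : ℝ) - 1) * (N : ℝ) ^ 2 * |β| / ((N : ℝ) ^ 2 - 1) with hC₀
  have hterm : ∀ ν' ∈ Finset.univ.erase ν₀, ∀ ε' : Bool,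
      ‖(∫ U, (fundamentalRep (Fin N) (wordHolonomy U (x.shift μ) (rw' ++ plaqWord ν₀ ν' ε'))).trace
          ∂(wilsonMeasure (d := d) (L := L) (fundamentalRep (Fin N)) β)) -
        (∫ U, (fundamentalRep (Fin N) (wordHolonomy U (x.shift μ) (rw' ++ (plaqWord ν₀ ν' ε').reverse))).trace
          ∂(wilsonMeasure (d := d) (L := L) (fundamentalRep (Fin N)) β)) -
        1 / (N : ℂ) * ((∫ U, (fundamentalRep (Fin N) (wordHolonomy U (x.shift μ) rw')).trace *
            (fundamentalRep (Fin N) (wordHolonomy U (x.shift μ) (plaqWord ν₀ ν' ε'))).trace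
              ∂(wilsonMeasure (d := d) (L := L) (fundamentalRep (Fin N)) β)) -
          (∫ U, (fundamentalRep (Fin N) (wordHolonomy U (x.shift μ) rw')).trace *
            (fundamentalRep (Fin N) (wordHolonomy U (x.shift μ) (plaqWord ν₀ ν' ε').reverse)).trace
              ∂(wilsonMeasure (d := d) (L := L) (fundamentalRep (Fin N)) β)))‖ ≤ 2 * C₀ + 1 / N * (2 * (C₀ * N)) := by
    intro ν' hν' ε'
    have hν'ν₀ : ν' ≠ ν₀ := (Finset.mem_erase.1 hν').1
    refine norm_four_piece_le ?_ ?_ ?_ ?_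
    · exact norm_integral_trace_rot_append_le hN hL β x hμν₀ hνμ hne hw hν'ν₀ ε' (Or.inl rfl)
    · exact norm_integral_trace_rot_append_le hN hL β x hμν₀ hνμ hne hw hν'ν₀ ε' (Or.inr rfl)
    · have h := norm_integral_trace_rot_mul_trace_le hN hL β x hμν₀ hνμ hne hw hν'ν₀ ε' (Or.inl rfl)
      rw [hC₀]; convert h using 1; ring
    · have h := norm_integral_trace_rot_mul_trace_le hN hL β x hμν₀ hνμ hne hw hν'ν₀ ε' (Or.inr rfl)
      rw [hC₀]; convert h using 1; ring
  have hS := norm_sum_sum_le_of_le hterm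
  have h4 : 2 * C₀ + 1 / N * (2 * (C₀ * N)) = 4 * C₀ := by field_simp; ring
  rw [h4] at hS
  rw [coeff_cast hN] at heq'
  have hmain := norm_le_of_coeff_mul_eq (coeff_pos hN) heq' hS
  -- back to `P̃₀ · w` read from `x`
  have hrot : ∀ U : GaugeConfig d L (Matrix.specialUnitaryGroup (Fin N) ℂ),
      (fundamentalRep (Fin N) (wordHolonomy U x (plaqWord μ ν₀ true ++ w))).trace =
        (fundamentalRep (Fin N) (wordHolonomy U (x.shift μ) rw')).trace :=
    fun U => trace_wordHolonomy_plaqWord_append U x μ ν₀ w hwx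
  simp_rw [hrot]
  refine hmain.trans (le_of_eq ?_)
  rw [hC₀, ← sq_abs β]
  field_simp
  ring

/-! ## The double traces `E[tr U_P · tr hol w]` are `O(β²)` -/

/-- ★★ **`‖E[tr U_P · tr hol_x w]‖ ≤ 16(d−1)²N⁴β²/(N²−1)²`** for `w ∈ {q, q⁻¹}` as above: the two-word loop equation of
the re-based marked plaquette at `(x + e_μ, ν₀)` with spectator `w` (no merge terms) has all its plaquette-term
constituents `O(β)`. [folklore] -/
theorem norm_integral_trace_mul_trace_qw_le₂ (hN : 2 ≤ N) (hL : (1 : ZMod L) ≠ 0) (β : ℝ) (x : Site d L)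
    {μ ν₀ ν : Fin d} (hμν₀ : μ ≠ ν₀) (hνμ : ν ≠ μ) {ε : Bool} (hne : ¬(ν = ν₀ ∧ ε = true)) {w : Word d}
    (hw : w = plaqWord μ ν ε ∨ w = (plaqWord μ ν ε).reverse) :
    ‖∫ U, (fundamentalRep (Fin N) (wordHolonomy U x (plaqWord μ ν₀ true))).trace *
        (fundamentalRep (Fin N) (wordHolonomy U x w)).trace ∂(wilsonMeasure (d := d) (L := L) (fundamentalRep (Fin N)) β)‖ ≤
      16 * ((d : ℝ) - 1) ^ 2 * (N : ℝ) ^ 4 * β ^ 2 / ((N : ℝ) ^ 2 - 1) ^ 2 := by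
  have hN2 : (2 : ℝ) ≤ N := by exact_mod_cast hN
  have hNpos : (0 : ℝ) < N := by linarith
  have hN21 : (0 : ℝ) < (N : ℝ) ^ 2 - 1 := by nlinarith
  have hd1 : (0 : ℝ) ≤ (d : ℝ) - 1 := sub_one_nonneg_of_axis μ
  have hν₀μ : ν₀ ≠ μ := fun h => hμν₀ h.symm
  have hμν : μ ≠ ν := fun h => hνμ h.symm
  have havoid : Word.Avoids x w (x.shift μ, ν₀) := by
    rcases hw with rfl | rfl
    · exact avoids_plaqWord hL x hμν₀ hμν hne
    · exact avoids_plaqWord_reverse hL x hμν₀ hμν hne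
  -- the two-word loop equation at `(x + e_μ, ν₀)`, marked word `P̃_{μ,−}` there, spectator `w` from `x`
  have h := loopEquation₂_specialUnitaryGroup (d := d) (L := L) N β (x.shift μ) ν₀ (plaqWord ν₀ μ false)
    (endpoint_plaqWord _ ν₀ μ false) x w
  have hi1 : ∀ k, Integrable (fun U : GaugeConfig d L (Matrix.specialUnitaryGroup (Fin N) ℂ) =>
      splitTerm (fundamentalRep (Fin N)) 1 (x.shift μ) ν₀ U (plaqWord ν₀ μ false) k *
        (fundamentalRep (Fin N) (wordHolonomy U x w)).trace) (wilsonMeasure (d := d) (L := L) (fundamentalRep (Fin N)) β) :=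
    fun k => integrable_of_continuous (fundamentalLatticeRep N) β
      ((continuous_splitTerm (fundamentalLatticeRep N) 1 (x.shift μ) ν₀ _ k).mul
        (continuous_trace_wordHolonomy (fundamentalLatticeRep N) x w))
  have hi2 : ∀ k, Integrable (fun U : GaugeConfig d L (Matrix.specialUnitaryGroup (Fin N) ℂ) =>
      mergeTerm (fundamentalRep (Fin N)) 1 (x.shift μ) ν₀ U (plaqWord ν₀ μ false) x w k)
      (wilsonMeasure (d := d) (L := L) (fundamentalRep (Fin N)) β) :=
    fun k => integrable_of_continuous (fundamentalLatticeRep N) β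
      (continuous_mergeTerm (fundamentalLatticeRep N) 1 (x.shift μ) ν₀ _ x w k)
  rw [← integral_finsetSum _ fun k _ => hi1 k, ← integral_finsetSum _ fun k _ => hi2 k] at h
  simp_rw [← Finset.sum_mul, Equipartition.sum_splitTerm_plaqWord (fundamentalRep (Fin N)) hL 1 (x.shift μ) hν₀μ _ false,
    sum_mergeTerm_eq_zero_of_avoids 1 (x.shift μ) ν₀ _ (plaqWord ν₀ μ false) x havoid, integral_zero, add_zero] at h
  have e1 : ∀ U : GaugeConfig d L (Matrix.specialUnitaryGroup (Fin N) ℂ),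
      ((N : ℂ) - 1 / N) * (fundamentalRep (Fin N) (wordHolonomy U (x.shift μ) (plaqWord ν₀ μ false))).trace *
        (fundamentalRep (Fin N) (wordHolonomy U x w)).trace = ((N : ℂ) - 1 / N) *
        ((fundamentalRep (Fin N) (wordHolonomy U (x.shift μ) (plaqWord ν₀ μ false))).trace *
          (fundamentalRep (Fin N) (wordHolonomy U x w)).trace) := fun U => by ring
  simp_rw [e1] at h
  rw [integral_const_mul] at h
  -- bound on the plaquette terms
  set C₀ : ℝ := 4 * ((d : ℝ) - 1) * (N : ℝ) ^ 2 * |β| / ((N : ℝ) ^ 2 - 1) with hC₀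
  have hterm : ∀ ν' ∈ Finset.univ.erase ν₀, ∀ ε' : Bool,
      ‖∫ U, plaqTerm (fundamentalRep (Fin N)) 1 (x.shift μ) ν₀ U (plaqWord ν₀ μ false) ν' ε' *
          (fundamentalRep (Fin N) (wordHolonomy U x w)).trace ∂(wilsonMeasure (d := d) (L := L) (fundamentalRep (Fin N)) β)‖ ≤
        2 * (C₀ * N) + 1 / N * (2 * (C₀ * (N * N))) := by
    intro ν' hν' ε'
    have hν'ν₀ : ν' ≠ ν₀ := (Finset.mem_erase.1 hν').1
    rw [integral_plaqTerm_mul_trace_suN]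
    refine norm_four_piece_le ?_ ?_ ?_ ?_
    · have h := norm_integral_trace_rebased_append_mul_trace_le hN hL β x hμν₀ hνμ hne hw hν'ν₀ ε' (Or.inl rfl)
      rw [hC₀]; convert h using 1; ring
    · have h := norm_integral_trace_rebased_append_mul_trace_le hN hL β x hμν₀ hνμ hne hw hν'ν₀ ε' (Or.inr rfl)
      rw [hC₀]; convert h using 1; ring
    · have h := norm_integral_trace_rebased_mul_trace_mul_trace_le hN hL β x hμν₀ hνμ hne hw hν'ν₀ ε' (Or.inl rfl)
      rw [hC₀]; convert h using 1; ring
    · have h := norm_integral_trace_rebased_mul_trace_mul_trace_le hN hL β x hμν₀ hνμ hne hw hν'ν₀ ε' (Or.inr rfl)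
      rw [hC₀]; convert h using 1; ring
  have hS := norm_sum_sum_le_of_le hterm
  have h4 : 2 * (C₀ * N) + 1 / N * (2 * (C₀ * (N * N))) = 4 * (C₀ * N) := by field_simp; ring
  rw [h4] at hS
  rw [coeff_cast hN] at h
  have hmain := norm_le_of_coeff_mul_eq (coeff_pos hN) (eq_neg_of_add_eq_zero_left h) hS
  simp_rw [← trace_wordHolonomy_plaqWord_rot] at hmain
  refine hmain.trans (le_of_eq ?_)
  rw [hC₀, ← sq_abs β]
  field_simp
  ring

/-- ★★ **THE DEFORMED-PLAQUETTE TERMS ARE `O(β²)`**: for `(ν, ε) ≠ (ν₀, +)`, `ν ≠ μ` (`SU(N)`, `N ≥ 2`, `L ≥ 2`, every real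
`β`), the `(ν, ε)` plaquette term of the loop equation of `P̃₀` at `(x, μ)` satisfies
`‖E[tr hol(P̃₀q)] − E[tr hol(P̃₀q⁻¹)] − (1/N)(E[tr U_P tr hol q] − E[tr U_P tr hol q⁻¹])‖ ≤ 64(d−1)²N³β²/(N²−1)²`. [folklore] -/
theorem norm_plaqTermIntegral_le₂ (hN : 2 ≤ N) (hL : (1 : ZMod L) ≠ 0) (β : ℝ) (x : Site d L) {μ ν₀ ν : Fin d}
    (hμν₀ : μ ≠ ν₀) (hνμ : ν ≠ μ) {ε : Bool} (hne : ¬(ν = ν₀ ∧ ε = true)) :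
    ‖(∫ U, (fundamentalRep (Fin N) (wordHolonomy U x (plaqWord μ ν₀ true ++ plaqWord μ ν ε))).trace
        ∂(wilsonMeasure (d := d) (L := L) (fundamentalRep (Fin N)) β)) -
      (∫ U, (fundamentalRep (Fin N) (wordHolonomy U x (plaqWord μ ν₀ true ++ (plaqWord μ ν ε).reverse))).trace
        ∂(wilsonMeasure (d := d) (L := L) (fundamentalRep (Fin N)) β)) -
      1 / (N : ℂ) * ((∫ U, (fundamentalRep (Fin N) (wordHolonomy U x (plaqWord μ ν₀ true))).trace *
          (fundamentalRep (Fin N) (wordHolonomy U x (plaqWord μ ν ε))).trace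
            ∂(wilsonMeasure (d := d) (L := L) (fundamentalRep (Fin N)) β)) -
        ∫ U, (fundamentalRep (Fin N) (wordHolonomy U x (plaqWord μ ν₀ true))).trace *
          (fundamentalRep (Fin N) (wordHolonomy U x (plaqWord μ ν ε).reverse)).trace
            ∂(wilsonMeasure (d := d) (L := L) (fundamentalRep (Fin N)) β))‖ ≤
      64 * ((d : ℝ) - 1) ^ 2 * (N : ℝ) ^ 3 * β ^ 2 / ((N : ℝ) ^ 2 - 1) ^ 2 := by
  have hN2 : (2 : ℝ) ≤ N := by exact_mod_cast hN
  have hNpos : (0 : ℝ) < N := by linarith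
  have hN21 : (0 : ℝ) < (N : ℝ) ^ 2 - 1 := by nlinarith
  have h1 := norm_integral_trace_plaqWord_append_qw_le₂ (d := d) (L := L) hN hL β x hμν₀ hνμ hne (Or.inl rfl)
  have h2 := norm_integral_trace_plaqWord_append_qw_le₂ (d := d) (L := L) hN hL β x hμν₀ hνμ hne (Or.inr rfl)
  have h3 := norm_integral_trace_mul_trace_qw_le₂ (d := d) (L := L) hN hL β x hμν₀ hνμ hne (Or.inl rfl)
  have h4 := norm_integral_trace_mul_trace_qw_le₂ (d := d) (L := L) hN hL β x hμν₀ hνμ hne (Or.inr rfl)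
  refine (norm_four_piece_le h1 h2 h3 h4).trans (le_of_eq ?_)
  field_simp
  ring

end Main

end StrongCoupling

end Summit.QuantumFields.GaugeBoot

end
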